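import Literature.AlgebraicGeometry.HodgeTheory.UnitaryTwoOneTimesCMCurveSquareCodimTwo
import Literature.AlgebraicGeometry.HodgeTheory.EllSlotsTypedWordsShapes
import Literature.AlgebraicGeometry.HodgeTheory.EllSlotsMonomialKunnethBasis
import Literature.AlgebraicGeometry.HodgeTheory.HodgeTypeVanishing
import Literature.AlgebraicGeometry.HodgeTheory.ExpTwistClassesComposition
import HarnessLib

/-!
# `Y × E³`: rational descent of a Künneth factor along a point class of `E³` (`H²(E)` a line; cup-product algebra)

Family `hodge`, layer `Literature/AlgebraicGeometry/HodgeTheory`. Written for the cell `pub-hodgeav-hg6` (LADDER-HodgeAV row 2,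
TABLE X row 21 `g6.E3xY3.(2,1)`, census programme γ2, brick γ2-D(ii) «`X`-side, descent», eng-2 g6; honest framing of that cell:
HC / HC_AV / HC_CM NOT proved — THIS file is UNCONDITIONAL). Theorems only (no definition, no named fact, D-0026; nothing admitted).

* `cup_fst_three_snd_two_cup_one`, `map_prodMap_id_cupProduct_fst_snd`, `cupProduct_comm_one` — cup-product
  algebra on `Y × S` (reassociation past an even class; pull-back along `𝟙 × g`).
* `EllipticCurve.exists_eq_smul_cup_basis`, `EllipticCurve.exists_cup_basis_eq_smul` — `H²(E(ℂ); ℂ) = ℂ · e₀ ⌣ e₁` for any basis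
  `e` of `H¹(E)`, and `f₀ ⌣ f₁ = κ e₀ ⌣ e₁` with `κ ≠ 0` for two bases.
* `isRationalClass_of_sum_cup_slot_cup_pointClass` — **rational descent**: on `X = Y × E³` (`E³ = E.powSucc 2`, slots `q_i`), for a
  rational basis `e` of `H¹(E)` and slots `a ≠ b′`, if `Σ_j (pr_Y^* γ_j ⌣ pr_S^* q_{b′}^* e_j) ⌣ pr_S^*(q_a^* e₀ ⌣ q_a^* e₁)` is a rational
  class then `γ₀, γ₁ ∈ H³(Y)` are rational: the Künneth coefficients of that class along the rational cup-monomial basis of `H•(E³)`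
  (`EllSlots.exists_cupMonomialBasis`) at the subsets `{(a,0),(a,1),(b′,j)}` are `± γ_j` (`kunneth_symm_cupProduct_eq_sum`,
  `cupMonomialBasis_std_two_one`), and Künneth coefficients of rational classes along rational bases are rational
  (`isRationalClass_kunneth_symm_apply`). This is the rationality half of «the `N_{ab′}`-Künneth block of a Hodge class of `Y × E³` is
  a product `a ⌣ b`» in Moonen–Zarhin's description of the Hodge ring of `T × E³`.

## Sources

* [MoonenZarhin1999LowDim] B. Moonen, Yu. Zarhin, Hodge classes on abelian varieties of low dimension, Math. Ann. 315 (1999),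
  Thm. 0.2 (1), §5 (5.3), (5.12) (arXiv v2 = Math. Ann. numbering: the case (e) analysis is item (5.12); earlier tree copies of the R41 family wrote «(5.11)»).
* [HatcherAT2002] A. Hatcher, *Algebraic Topology* (2002), §3.2 Prop. 3.10, Thm. 3.11, Thm. 3.16.
* [LangeBirkenhake1992] H. Lange, Ch. Birkenhake, *Complex Abelian Varieties* (1992), Lemma 1.1.17, Exercise 1.1.6 (8).
* [VoisinHodgeI2002] C. Voisin, *Hodge Theory and Complex Algebraic Geometry I* (2002), §7.1.1, §11.3.2.
-/

noncomputable section

open scoped TensorProduct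
open CategoryTheory Module

namespace Literature.AlgebraicGeometry.HodgeTheory

open Literature.AlgebraicTopology.SingularHomology
open Literature.AlgebraicGeometry.Motives (IsSmoothProjective AbelianVariety bettiCohomology
  ofRatClassBaseChange)
open Literature.Barriers.HodgeConjecture
open Literature.AlgebraicGeometry.Motives.HodgeStructure
open Literature.AlgebraicGeometry.ComplexMultiplication
open Literature.RepresentationTheory.GeneralLinear
open Literature.NumberTheory.DiophantineGeometry

/-! ### §1 Cup-product algebra on `Y × S` -/

section CupAlgebra

variable {Y S : AbelianVariety ℂ}

/-- Degree-one classes anticommute. [cite: HatcherAT2002, §3.2 Thm. 3.11] -/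
theorem cupProduct_comm_one {T : Type} [TopologicalSpace T] (a b : singularCohomology ℂ ℂ T 1) :
    cupProduct (rfl : 1 + 1 = 2) a b = -cupProduct (rfl : 1 + 1 = 2) b a := by
  rw [cupProduct_gradedComm_holds ℂ T rfl rfl a b, mul_one, pow_one, neg_one_smul]

/-- `pr_Y^* γ ⌣ pr_S^*(d ⌣ ℓ) = (pr_Y^* γ ⌣ pr_S^* ℓ) ⌣ pr_S^* d` for `deg γ = 3`, `deg d = 2`, `deg ℓ = 1` (associativity and
commutativity with the even class `d`). [cite: HatcherAT2002, §3.2 Prop. 3.10 and Thm. 3.11] -/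
theorem cup_fst_three_snd_two_cup_one (γ : complexBetti Y.X 3) (d : complexBetti S.X 2) (ℓ : complexBetti S.X 1) :
    cupProduct (show 3 + 3 = 2 * 3 by norm_num) (complexBetti.map (Motives.AbelianVariety.fst Y S).hom.hom.hom 3 γ)
      (complexBetti.map (Motives.AbelianVariety.snd Y S).hom.hom.hom 3 (cupProduct (show 2 + 1 = 3 by norm_num) d ℓ)) =
    cupProduct (show 2 * 2 + 2 * 1 = 2 * 3 by norm_num)
      (cupProduct (show 3 + 1 = 2 * 2 by norm_num) (complexBetti.map (Motives.AbelianVariety.fst Y S).hom.hom.hom 3 γ)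
        (complexBetti.map (Motives.AbelianVariety.snd Y S).hom.hom.hom 1 ℓ))
      (complexBetti.map (Motives.AbelianVariety.snd Y S).hom.hom.hom 2 d) := by
  rw [complexBetti.map_cupProduct,
    cupProduct_comm_of_deg_two (show 2 + 1 = 3 by norm_num) (show 1 + 2 = 3 by norm_num),
    ← cupProduct_assoc (show 3 + 1 = 2 * 2 by norm_num) (show 1 + 2 = 3 by norm_num) (show 2 * 2 + 2 * 1 = 2 * 3 by norm_num)
      (show 3 + 3 = 2 * 3 by norm_num)]

/-- Pull-back of `pr_Y^* u ⌣ pr_S^* v` along `𝟙 × g`: `(𝟙 × g)^*(pr_Y^* u ⌣ pr_S^* v) = pr_Y^* u ⌣ pr_S^*(g^* v)`.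
[cite: HatcherAT2002, §3.2 Prop. 3.10] -/
theorem map_prodMap_id_cupProduct_fst_snd (g : S ⟶ S) {m r k : ℕ} (hmr : m + r = k) (u : complexBetti Y.X m)
    (v : complexBetti S.X r) :
    complexBetti.map (Motives.AbelianVariety.prodMap (𝟙 Y) g).hom.hom.hom k
      (cupProduct hmr (complexBetti.map (Motives.AbelianVariety.fst Y S).hom.hom.hom m u)
        (complexBetti.map (Motives.AbelianVariety.snd Y S).hom.hom.hom r v)) =
    cupProduct hmr (complexBetti.map (Motives.AbelianVariety.fst Y S).hom.hom.hom m u)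
      (complexBetti.map (Motives.AbelianVariety.snd Y S).hom.hom.hom r (complexBetti.map g.hom.hom.hom r v)) := by
  rw [complexBetti.map_cupProduct, abelianVarietyHom_map_map_apply, abelianVarietyHom_map_map_apply,
    Motives.AbelianVariety.prodMap_fst, Motives.AbelianVariety.prodMap_snd, Category.comp_id, ← abelianVarietyHom_map_map_apply]

end CupAlgebra

/-! ### §2 `H²(E)` is the line `ℂ · e₀ ⌣ e₁` -/

section CurveTop

variable {E : AbelianVariety ℂ}

/-- The two elements of `Fin 2`. [folklore] -/
private theorem fin2_eq_zero_or_one_cc (r : Fin 2) : r = 0 ∨ r = 1 := by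
  fin_cases r <;> simp

/-- The two-letter cup monomial is the cup product. [cite: HatcherAT2002, §3.2 Prop. 3.10] -/
theorem cupPowOne_two_basis (e : Module.Basis (Fin 2) ℂ (complexBetti E.X 1)) (w : Fin 2 → Fin 2) :
    cupPowOne ℂ (Motives.ComplexPoints E.X) 2 (⇑e ∘ w) = cupProduct (rfl : 1 + 1 = 2) (e (w 0)) (e (w 1)) := by
  change cupPowOne ℂ (Motives.ComplexPoints E.X) (1 + 1) (⇑e ∘ w) = _
  rw [cupPowOne_succ, cupPowOne_one]; rfl

/-- Every cup monomial in a basis `e₀, e₁` of `H¹(E)` is a multiple of `e₀ ⌣ e₁`. [cite: LangeBirkenhake1992, Lemma 1.1.17] -/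
theorem cupPowOne_two_basis_mem_span (e : Module.Basis (Fin 2) ℂ (complexBetti E.X 1)) (w : Fin 2 → Fin 2) :
    cupPowOne ℂ (Motives.ComplexPoints E.X) 2 (⇑e ∘ w) ∈ Submodule.span ℂ {cupProduct (rfl : 1 + 1 = 2) (e 0) (e 1)} := by
  rw [cupPowOne_two_basis]
  rcases fin2_eq_zero_or_one_cc (w 0) with h0 | h0 <;> rcases fin2_eq_zero_or_one_cc (w 1) with h1 | h1
  · rw [h0, h1, cup_self_deg_one]; exact Submodule.zero_mem _
  · rw [h0, h1]; exact Submodule.subset_span rfl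
  · rw [h0, h1, cupProduct_gradedComm_holds ℂ _ rfl rfl (e 1) (e 0)]; exact Submodule.smul_mem _ _ (Submodule.subset_span rfl)
  · rw [h0, h1, cup_self_deg_one]; exact Submodule.zero_mem _

/-- `H²(E(ℂ); ℂ) = ℂ · e₀ ⌣ e₁` for a basis `e₀, e₁` of `H¹(E)`. [cite: LangeBirkenhake1992, Lemma 1.1.17 and Exercise 1.1.6 (8)] -/
theorem EllipticCurve.exists_eq_smul_cup_basis (e : Module.Basis (Fin 2) ℂ (complexBetti E.X 1)) (x : complexBetti E.X 2) :
    ∃ κ : ℂ, x = κ • cupProduct (rfl : 1 + 1 = 2) (e 0) (e 1) := by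
  have hspan := span_range_cupPowOne_basis (B := E) e 2
  have htop : x ∈ Submodule.span ℂ (Set.range fun w : Fin 2 → Fin 2 =>
      cupPowOne ℂ (Motives.ComplexPoints E.X) 2 (⇑e ∘ w)) := by
    rw [hspan]; exact Submodule.mem_top
  have hx : x ∈ Submodule.span ℂ {cupProduct (rfl : 1 + 1 = 2) (e 0) (e 1)} := by
    refine Submodule.span_le.2 ?_ htop
    rintro _ ⟨w, rfl⟩
    exact cupPowOne_two_basis_mem_span e w
  obtain ⟨κ, hκ⟩ := Submodule.mem_span_singleton.1 hx
  exact ⟨κ, hκ.symm⟩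

/-- For two bases `f`, `e` of `H¹(E(ℂ); ℂ)` of an elliptic curve: `f₀ ⌣ f₁ = κ · e₀ ⌣ e₁` with `κ ≠ 0` (`H²(E) = ⋀² H¹` is a line
spanned by the monomial of any basis). [cite: LangeBirkenhake1992, Lemma 1.1.17 and Exercise 1.1.6 (8)] -/
theorem EllipticCurve.exists_cup_basis_eq_smul (f e : Module.Basis (Fin 2) ℂ (complexBetti E.X 1)) :
    ∃ κ : ℂ, κ ≠ 0 ∧ cupProduct (rfl : 1 + 1 = 2) (f 0) (f 1) = κ • cupProduct (rfl : 1 + 1 = 2) (e 0) (e 1) := by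
  classical
  obtain ⟨κ, hκ⟩ := EllipticCurve.exists_eq_smul_cup_basis e (cupProduct (rfl : 1 + 1 = 2) (f 0) (f 1))
  refine ⟨κ, fun h0 => ?_, hκ⟩
  -- `f₀ ⌣ f₁ ≠ 0`: it is the image of the basis vector `f₀ ∧ f₁` of `⋀² H¹` under the comparison isomorphism
  rw [h0, zero_smul] at hκ
  have hne : cupPowOne ℂ (Motives.ComplexPoints E.X) 2 (⇑f ∘ ![0, 1]) ≠ 0 := by
    intro h
    have hι : exteriorPower.ιMulti ℂ 2 (⇑f ∘ ![0, 1]) = 0 := by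
      rw [← Motives.abelianVarietyCohomologyExteriorH1_holds.wedgeToCup_eq_zero_iff E 2, wedgeToCup_ιMulti]
      exact h
    have hfam : exteriorPower.ιMulti ℂ 2 (⇑f ∘ ![0, 1]) =
        f.exteriorPower 2 (Set.powersetCard.ofCard (s := ({0, 1} : Finset (Fin 2))) (by decide)) := by
      rw [exteriorPower.basis_apply]
      change _ = exteriorPower.ιMulti ℂ 2 (⇑f ∘ (Set.powersetCard.ofFinEmbEquiv.symm _))
      congr 1
      funext i
      simp only [Function.comp_apply, Set.powersetCard.ofFinEmbEquiv_symm_apply]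
      congr 1
      have huniv : (({0, 1} : Finset (Fin 2))) = Finset.univ := by decide
      have hmono : StrictMono (![0, 1] : Fin 2 → Fin 2) := by
        intro i j hij
        fin_cases i <;> fin_cases j <;> simp_all
      have h := Finset.orderEmbOfFin_unique (s := ({0, 1} : Finset (Fin 2))) (by decide : ({0, 1} : Finset (Fin 2)).card = 2)
        (f := (![0, 1] : Fin 2 → Fin 2)) (fun i => by rw [huniv]; exact Finset.mem_univ _) hmono
      exact congrFun h i
    rw [hfam] at hι
    exact (f.exteriorPower 2).ne_zero _ hι
  apply hne
  change cupPowOne ℂ (Motives.ComplexPoints E.X) (1 + 1) (⇑f ∘ ![0, 1]) = 0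
  rw [cupPowOne_succ, cupPowOne_one]
  exact hκ

end CurveTop

/-! ### §3 Rational descent along a point-class factor of `E³` -/

section Descent

variable {Y E : AbelianVariety ℂ}

/-- **Rational descent along `q_a^*[pt]`.** On `X = Y × E³` let `e` be a rational basis of `H¹(E)`, `a ≠ b′` two slots of
`E³ = E.powSucc 2`, and `γ₀, γ₁ ∈ H³(Y)`. If the class
`Σ_j (pr_Y^* γ_j ⌣ pr_S^* q_{b′}^* e_j) ⌣ pr_S^*(q_a^* e₀ ⌣ q_a^* e₁)` is rational, then `γ₀` and `γ₁` are rational: its Künneth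
coefficients along the rational cup-monomial basis of `H•(E³)` at the two subsets `{(a,0),(a,1),(b′,j)}` are `± γ_j`, and the Künneth
coefficients of a rational class along a rational basis are rational (`isRationalClass_kunneth_symm_apply`).
[cite: MoonenZarhin1999LowDim, §5 (5.3), (5.12)] [cite: HatcherAT2002, §3.2 Thm. 3.16] [cite: VoisinHodgeI2002, §7.1.1 and §11.3.2] -/
theorem isRationalClass_of_sum_cup_slot_cup_pointClass (hE1 : E.dim = 1)
    {e : Module.Basis (Fin 2) ℂ (complexBetti E.X 1)} (he : ∀ ℓ, IsRationalClass (e ℓ)) {a b' : Fin 3} (hab : a ≠ b')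
    (γ : Fin 2 → complexBetti Y.X 3)
    (hQ : IsRationalClass (cupProduct (show 2 * 2 + 2 * 1 = 2 * 3 by norm_num)
      (∑ j, cupProduct (show 3 + 1 = 2 * 2 by norm_num)
        (complexBetti.map (Motives.AbelianVariety.fst Y (E.powSucc 2)).hom.hom.hom 3 (γ j))
        (complexBetti.map (Motives.AbelianVariety.snd Y (E.powSucc 2)).hom.hom.hom 1 (slotLetters (powSlots E 2) e (b', j))))
      (complexBetti.map (Motives.AbelianVariety.snd Y (E.powSucc 2)).hom.hom.hom 2
        (cupProduct (rfl : 1 + 1 = 2) (slotLetters (powSlots E 2) e (a, 0)) (slotLetters (powSlots E 2) e (a, 1)))))) :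
    ∀ j, IsRationalClass (γ j) := by
  classical
  have hS3 : (E.powSucc 2).dim = 3 := by
    change ((E.prod E).prod E).dim = 3
    rw [Motives.AbelianVariety.dim_prod, Motives.AbelianVariety.dim_prod, hE1]
  have hYs : IsSmoothProjective Y.dim Y.X := AbelianVariety.isSmoothProjective_holds
  have hSs : IsSmoothProjective (E.powSucc 2).dim (E.powSucc 2).X := AbelianVariety.isSmoothProjective_holds
  have hg : EllSlots E (E.powSucc 2) (powSlots E 2) := EllSlots.powSucc hE1 2
  obtain ⟨b, hb⟩ := hg.exists_cupMonomialBasis e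
  have hbQ : ∀ k s, IsRationalClass (b k s) := isRationalClass_cupMonomialBasis he b hb
  set θ := LinearEquiv.ofBijective _ (complexBetti_kunneth_bijective hYs hSs (fun j => b j) (2 * 3)) with hθ
  have h3 : 3 < 2 * (E.powSucc 2).dim + 1 := by rw [hS3]; norm_num
  -- the two indices
  let J : Fin 2 → LerayHirsch.Idx (fun J : (Σ j : Fin (2 * (E.powSucc 2).dim + 1), Set.powersetCard (Fin (3 * 2)) j) =>
      (J.1 : ℕ)) (2 * 3) :=
    fun j => ⟨⟨⟨3, h3⟩, Set.powersetCard.ofCard (card_image_stdWord_two_one hab j)⟩, by change 3 ≤ 2 * 3; norm_num⟩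
  have hJinj : Function.Injective J := by
    intro j j' hjj'
    have h := congrArg (fun I : LerayHirsch.Idx (fun J : (Σ j : Fin (2 * (E.powSucc 2).dim + 1),
      Set.powersetCard (Fin (3 * 2)) j) => (J.1 : ℕ)) (2 * 3) => I.1) hjj'
    simp only [J, Sigma.mk.injEq, heq_eq_eq, true_and] at h
    exact stdSubset_two_one_injective hab h
  -- the basis vectors at these indices
  choose ε hε hbε using fun j => cupMonomialBasis_std_two_one e b hb hab j
  have hε1 : ∀ j, (ε j * ε j : ℤ) = 1 := fun j => by rcases hε j with h | h <;> rw [h] <;> norm_num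
  have h36 : ((⟨3, h3⟩ : Fin (2 * (E.powSucc 2).dim + 1)) : ℕ) ≤ 2 * 3 := by change 3 ≤ 2 * 3; norm_num
  -- the class, rewritten as `Σ_j ε_j · pr_Y^* γ_j ⌣ pr_S^* b₃(s_j)`
  set x := cupProduct (show 2 * 2 + 2 * 1 = 2 * 3 by norm_num)
      (∑ j, cupProduct (show 3 + 1 = 2 * 2 by norm_num)
        (complexBetti.map (Motives.AbelianVariety.fst Y (E.powSucc 2)).hom.hom.hom 3 (γ j))
        (complexBetti.map (Motives.AbelianVariety.snd Y (E.powSucc 2)).hom.hom.hom 1 (slotLetters (powSlots E 2) e (b', j))))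
      (complexBetti.map (Motives.AbelianVariety.snd Y (E.powSucc 2)).hom.hom.hom 2
        (cupProduct (rfl : 1 + 1 = 2) (slotLetters (powSlots E 2) e (a, 0)) (slotLetters (powSlots E 2) e (a, 1)))) with hx
  have hx' : x = ∑ j, ((ε j : ℂ) • cupProduct (Nat.sub_add_cancel h36)
      (complexBetti.map (Motives.AbelianVariety.fst Y (E.powSucc 2)).hom.hom.hom (2 * 3 - 3) (γ j))
      (complexBetti.map (Motives.AbelianVariety.snd Y (E.powSucc 2)).hom.hom.hom 3
        (b 3 (Set.powersetCard.ofCard (card_image_stdWord_two_one hab j))))) := by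
    rw [hx, map_sum, LinearMap.sum_apply]
    refine Finset.sum_congr rfl fun j _ => ?_
    rw [← cup_fst_three_snd_two_cup_one (γ j)]
    have hDℓ : cupProduct (show 2 + 1 = 3 by norm_num)
        (cupProduct (rfl : 1 + 1 = 2) (slotLetters (powSlots E 2) e (a, 0)) (slotLetters (powSlots E 2) e (a, 1)))
        (slotLetters (powSlots E 2) e (b', j)) =
        (ε j : ℂ) • b 3 (Set.powersetCard.ofCard (card_image_stdWord_two_one hab j)) := by
      rw [hbε j, smul_smul, ← Int.cast_mul, hε1 j, Int.cast_one, one_smul]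
    rw [hDℓ, map_smul, map_smul]
    rfl
  -- hence the Künneth coefficient of `x` at `J j` is `ε_j γ_j`, and it is rational
  have hkey : ∀ j, θ.symm (cupProduct (Nat.sub_add_cancel h36)
      (complexBetti.map (Motives.AbelianVariety.fst Y (E.powSucc 2)).hom.hom.hom (2 * 3 - 3) (γ j))
      (complexBetti.map (Motives.AbelianVariety.snd Y (E.powSucc 2)).hom.hom.hom 3
        (b 3 (Set.powersetCard.ofCard (card_image_stdWord_two_one hab j))))) = Pi.single (J j) (γ j) := by
    intro j
    have key : θ.symm (cupProduct (Nat.sub_add_cancel h36)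
        (complexBetti.map (Motives.AbelianVariety.fst Y (E.powSucc 2)).hom.hom.hom (2 * 3 - 3) (γ j))
        (complexBetti.map (Motives.AbelianVariety.snd Y (E.powSucc 2)).hom.hom.hom 3
          (b 3 (Set.powersetCard.ofCard (card_image_stdWord_two_one hab j))))) = _ :=
      kunneth_symm_cupProduct_eq_sum hYs hSs (fun j => b j) (2 * 3) (j := ⟨3, h3⟩) h36 (γ j)
        (b 3 (Set.powersetCard.ofCard (card_image_stdWord_two_one hab j)))
    rw [key]
    change ∑ i, (b 3).repr (b 3 (Set.powersetCard.ofCard (card_image_stdWord_two_one hab j))) i • _ = _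
    rw [Module.Basis.repr_self, Finset.sum_eq_single (Set.powersetCard.ofCard (card_image_stdWord_two_one hab j))]
    · rw [Finsupp.single_eq_same, one_smul]
    · intro i _ hi
      rw [Finsupp.single_apply, if_neg (fun h => hi h.symm), zero_smul]
    · exact fun h => absurd (Finset.mem_univ _) h
  intro j
  have hcoef : θ.symm x (J j) = (ε j : ℂ) • γ j := by
    have hθsum : θ.symm ((∑ j, ((ε j : ℂ) • cupProduct (Nat.sub_add_cancel h36)
        (complexBetti.map (Motives.AbelianVariety.fst Y (E.powSucc 2)).hom.hom.hom (2 * 3 - 3) (γ j))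
        (complexBetti.map (Motives.AbelianVariety.snd Y (E.powSucc 2)).hom.hom.hom 3
          (b 3 (Set.powersetCard.ofCard (card_image_stdWord_two_one hab j))))) :
          complexBetti (Y.prod (E.powSucc 2)).X (2 * 3))) =
        ∑ j, (ε j : ℂ) • θ.symm (cupProduct (Nat.sub_add_cancel h36)
        (complexBetti.map (Motives.AbelianVariety.fst Y (E.powSucc 2)).hom.hom.hom (2 * 3 - 3) (γ j))
        (complexBetti.map (Motives.AbelianVariety.snd Y (E.powSucc 2)).hom.hom.hom 3
          (b 3 (Set.powersetCard.ofCard (card_image_stdWord_two_one hab j))))) := by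
      exact (map_sum θ.symm _ _).trans (Finset.sum_congr rfl fun j _ => map_smul θ.symm _ _)
    rw [hx', hθsum, Finset.sum_apply, Fin.sum_univ_two, hkey, hkey, Pi.smul_apply, Pi.smul_apply]
    rcases Fin.exists_fin_two.1 ⟨j, rfl⟩ with h0 | h0 <;> rw [h0]
    · rw [Pi.single_eq_same, Pi.single_eq_of_ne (fun h => absurd (hJinj h) (by decide)), smul_zero, add_zero]
      rfl
    · rw [Pi.single_eq_of_ne (fun h => absurd (hJinj h) (by decide)), Pi.single_eq_same, smul_zero, zero_add]
      rfl
  have hrat : IsRationalClass ((ε j : ℂ) • γ j) := by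
    rw [← hcoef]
    exact isRationalClass_kunneth_symm_apply hYs hSs (fun j => b j) (fun j i => hbQ j i) (2 * 3) hQ (J j)
  have hback : γ j = ((ε j : ℚ) : ℂ) • ((ε j : ℂ) • γ j) := by
    rw [smul_smul, Rat.cast_intCast, ← Int.cast_mul, hε1 j, Int.cast_one, one_smul]
  rw [hback]
  exact hrat.smul _

end Descent

end Literature.AlgebraicGeometry.HodgeTheory

end
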